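import Summits.BirchSwinnertonDyer.BirchSwinnertonDyer.Theorems.OneSidedTwistSqueezeX9KatoDivisibilityX9StubTestCocyclePkLevelX9Defect
import Literature.NumberTheory.EllipticCurves.FineSelmerCoefficientMapProofs
import Literature.NumberTheory.EllipticCurves.SubgroupSelmerCocycleCriteriaProofs
import Literature.NumberTheory.EllipticCurves.ZpExtensionUnramifiedProofs
import Literature.NumberTheory.EllipticCurves.GoodReductionUnramifiedProofs
import Literature.NumberTheory.EllipticCurves.HasseWeilGoodReductionFrobeniusProofs
import Literature.NumberTheory.EllipticCurves.AnticyclotomicPrimeDecompositionAboveProofs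
import Literature.NumberTheory.EllipticCurves.IwasawaTwistModPkTower
import HarnessLib

/-!
# Crux `KatoDivisibilityX9` (stmt-BirchSwinnertonDyer-20547), line `graded_euler_loss`, stub
# `stub_testCocyclePkLevelX9` (g6), part 6: the coordinate cocycles of the test cocycle are
# PRINCIPAL on `D_v ∩ Γ_∞` — eventually at the place above `p`, immediately on inertia elsewhere

Seat `bsd-line-k6-p4` (prover-bsd-line-k6-p4-g6-0, stub worker 1a′).  THEOREMS ONLY (no definition,
no named fact, no `sorry`); `--supports stmt-BirchSwinnertonDyer-20547` helper; closes nothing.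

For a Weierstrass curve `W` over a field `K`, a prime `p`, `k : ℕ`, a `ℤ_p`-extension `κ`,
`Γ_∞ = ker κ`, `M_k = E[p^k] ↪ M_∞ = E[p^∞]` (`ι`), and the coordinate cocycles
`e_0, …, e_{L−1} ∈ Z¹(Γ_∞, M_k)` of a cocycle `ψ` of `𝒯^{(k)}_L(E, κ⁻¹)` (recursion
`e_i = γ·e_{i+1} − e_{i+1}`):

* §1 `exists_root_of_mem_fineSelmerInfty` — if `ι_*[c]` is FINE then at every finite place `v`
  the cocycle `ι ∘ c` is principal on `Γ_∞ ∩ D_v` ("root");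
  `apply_eq_zero_of_mem_inertia` — at a good place `v ∤ p` such a `c` VANISHES on the inertia group
  `I_{𝔓₀(v)}` (Néron–Ogg–Shafarevich on the root; `I ≤ Γ_∞ ∩ D_v`).
* §2 `oneCocycleClass_conj_sub_eq_zero` — `[γ·e_0 − e_0] = (conj_γ − 1)^L ι_*^{-1} t = 0` when
  `(conj_γ − 1)^L t = 0` and `E(K_∞)[p] = 0`.
* §3 `exists_principalBound` — THE DEFECT ARGUMENT: for `γ = d u₀` (`d ∈ D`, `u₀ ∈ Γ_∞`) there is
  `N₀` (depending on `W, p, k, D, d` only) such that for every family `e` as above whose top member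
  has a root on `D ∩ Γ_∞` and whose bottom member satisfies `[γ·e_0 − e_0] = 0`, every `e_i` with
  `L − 1 − i ≥ N₀` is principal on `D ∩ Γ_∞` OVER `M_k` (part 5: the defects
  `p^k·root ∈ B/p^kB`, `B = M_∞^{D ∩ Γ_∞}`, satisfy `δ_i = (d−1) δ_{i+1}` and `(d−1)^L δ_{L−1} = 0`
  in the finite group `B/p^kB`).
* §4 `shiftPowCocyclePk_principal` — hence the SHIFTED cocycle `S^m ψ` (`m ≥ N₀`) is principal on
  `D ∩ Γ_∞`, the input of the local engine `…LocalPEnginePk`.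

References: R. Greenberg, LNM 1716 (1999) §3 Lemma 3.1 [GreenbergLNM1716]; J.-P. Serre, *Galois
Cohomology* (1997) I §2.5, I §5.1 [SerreGaloisCohomology1997]; J. H. Silverman, *AEC* VII.4.1
[SilvermanAEC2009]; L. Washington (1997) Prop. 13.2, §13.1–13.2 [Washington1997].
-/

set_option autoImplicit false
-- the summit and its single problem are both named `BirchSwinnertonDyer` (registry layout D-0017)
set_option linter.dupNamespace false

noncomputable section

open scoped ContRepresentation NumberField
open Field NumberField IsDedekindDomain
open Literature.NumberTheory.GaloisRepresentations Literature.NumberTheory.EllipticCurves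
open Literature.NumberTheory.EllipticCurves.GreenbergSelmer (decomp)
open WeierstrassCurve (geomTorsion geomPrimaryTorsion geomPoints)
open Summit.BirchSwinnertonDyer.BirchSwinnertonDyer.Theorems.OneSidedTwistSqueezeX9KatoDivisibilityX9StubTestCocyclePkLevelX9Kummer
open Summit.BirchSwinnertonDyer.BirchSwinnertonDyer.Theorems.OneSidedTwistSqueezeX9KatoDivisibilityX9StubTestCocyclePkLevelX9Core
open Summit.BirchSwinnertonDyer.BirchSwinnertonDyer.Theorems.OneSidedTwistSqueezeX9KatoDivisibilityX9StubTestCocyclePkLevelX9Defect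

universe u

namespace Summit.BirchSwinnertonDyer.BirchSwinnertonDyer.Theorems.OneSidedTwistSqueezeX9KatoDivisibilityX9StubTestCocyclePkLevelX9Principal

variable {K : Type u} [Field K] (W : WeierstrassCurve K) (p : ℕ) [Fact p.Prime] (k : ℕ)
  (κ : ZpExtension K p)

/-! ## §1 Roots from the fine condition; vanishing on inertia away from `p` -/

section Fine

variable [NumberField K]

/-- **A FINE class is principal on `Γ_∞ ∩ D_v` over `E[p^∞]`**: if `ι_*[c] ∈ Sel₀(K_∞, E[p^∞])`
for a cocycle `c ∈ Z¹(Γ_∞, E[p^k])`, then at every finite place `v` there is `a ∈ E[p^∞]` with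
`ι (c u) = u•a − a` for `u ∈ Γ_∞ ∩ D_v` (`mem_fineSelmerInfty_iff_resOfLe` at `σ = 1`).
[cite: Greenberg1989, §1 p. 98] [cite: GreenbergLNM1716, §3] -/
theorem exists_root_of_mem_fineSelmerInfty
    (c : contOneCocycles (discreteTopRep κ.kerSubgroup (geomTorsion W ((p : ℤ) ^ k))))
    (hc : resH1Hom (ContinuousMonoidHom.id κ.kerSubgroup)
      (AddSubgroup.inclusion (pkTorsion_le_geomPrimaryTorsion W p k)) (fun _ _ => rfl)
      (oneCocycleClass _ c) ∈ W.fineSelmerInfty κ) (v : HeightOneSpectrum (𝓞 K)) :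
    ∃ a : geomPrimaryTorsion W p, ∀ (u : absoluteGaloisGroup K) (hu : u ∈ κ.kerSubgroup ⊓ decomp v),
      AddSubgroup.inclusion (pkTorsion_le_geomPrimaryTorsion W p k) (c.1 ⟨u, hu.1⟩) = u • a - a := by
  have h := ((FineSelmerCoefficientMap.mem_fineSelmerInfty_iff_resOfLe
    (M := geomPrimaryTorsion W p) κ _).mp hc).1 v 1
  rw [show conjH1 κ.kerSubgroup (geomPrimaryTorsion W p) (1 : absoluteGaloisGroup K) =
      AddMonoidHom.id _ from conjH1_one_holds κ.kerSubgroup _, AddMonoidHom.id_apply,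
    resH1Hom_id_oneCocycleClass, CocycleCriteria.resOfLe_oneCocycleClass_eq_zero_iff] at h
  obtain ⟨a, ha⟩ := h
  exact ⟨a, fun u hu => ha ⟨u, hu⟩⟩

/-- **Vanishing on inertia away from `p`**: at a finite place `v ∤ p` of good reduction, a cocycle
`c ∈ Z¹(Γ_∞, E[p^k])` with `ι (c u) = u•a − a` on `Γ_∞ ∩ D_v` (`a ∈ E[p^∞]`) vanishes on the inertia
group `I_{𝔓₀}` of the distinguished prime `𝔓₀ ∣ v`: `I_{𝔓₀} ≤ Γ_∞` (`ℤ_p`-extensions are unramified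
outside `p`), `I_{𝔓₀} ≤ D_v`, and `I_{𝔓₀}` fixes `E[p^∞]` (Néron–Ogg–Shafarevich).
[cite: SilvermanAEC2009, Prop. VII.4.1(a)] [cite: Washington1997, Prop. 13.2] -/
theorem apply_eq_zero_of_mem_inertia [W.IsElliptic] {v : HeightOneSpectrum (𝓞 K)}
    (hpv : (p : 𝓞 K) ∉ v.asIdeal) (hv : W.HasGoodReductionAt v)
    (c : contOneCocycles (discreteTopRep κ.kerSubgroup (geomTorsion W ((p : ℤ) ^ k))))
    {a : geomPrimaryTorsion W p}
    (ha : ∀ (u : absoluteGaloisGroup K) (hu : u ∈ κ.kerSubgroup ⊓ decomp v),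
      AddSubgroup.inclusion (pkTorsion_le_geomPrimaryTorsion W p k) (c.1 ⟨u, hu.1⟩) = u • a - a)
    {τ : absoluteGaloisGroup K}
    (hτ : τ ∈ (adicCompletionPrime K v).inertia (absoluteGaloisGroup K)) (hτK : τ ∈ κ.kerSubgroup) :
    c.1 ⟨τ, hτK⟩ = 0 := by
  have hτD : τ ∈ decomp v := ZpExtension.inertia_adicCompletionPrime_le_decomp v hτ
  have h := ha τ ⟨hτK, hτD⟩
  -- `τ • a = a` by Néron–Ogg–Shafarevich
  obtain ⟨j, hj⟩ := a.2
  have hpj : (((p ^ j : ℕ) : ℤ) : 𝓞 K) ∉ v.asIdeal := WeierstrassCurve.pow_natCast_not_mem hpv j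
  have hpj' : ((p ^ j : ℕ) : 𝓞 K) ∉ v.asIdeal := by rwa [Int.cast_natCast] at hpj
  have hfix : τ • a = a := Subtype.ext
    (W.smul_eq_of_mem_inertia_of_nsmul_eq_zero hv hpj' (adicCompletionPrime_mem_primesAbove K v) hτ hj)
  rw [hfix, sub_self, ← map_zero (AddSubgroup.inclusion (pkTorsion_le_geomPrimaryTorsion W p k))] at h
  exact AddSubgroup.inclusion_injective _ h

end Fine

/-! ## §2 The bottom class dies: `[γ·e_0 − e_0] = 0` -/

/-- **`[γ·e_0 − e_0] = 0`.**  For a family `e_0, …, e_{L−1} ∈ Z¹(Γ_∞, E[p^k])` with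
`e_i = γ·e_{i+1} − e_{i+1}` and `ι_*[e_{L−1}] = t`, `(conj_γ − 1)^L t = 0`:
`ι_*[γ·e_0 − e_0] = (conj_γ − 1)^L t = 0`, and `ι_*` is injective when `E(K_∞)[p^∞]` has no
`p`-torsion. [cite: GreenbergLNM1716, §3 Lemma 3.2 and §5 p. 114] -/
theorem oneCocycleClass_conj_sub_eq_zero {γ : absoluteGaloisGroup K}
    (hE : ∀ m : geomPrimaryTorsion W p, (∀ σ ∈ κ.kerSubgroup, σ • m = m) → p • m = 0 → m = 0)
    {L : ℕ} (hL : 0 < L)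
    (e : Fin L → contOneCocycles (discreteTopRep κ.kerSubgroup (geomTorsion W ((p : ℤ) ^ k))))
    (he : ∀ (i : Fin L) (hi : (i : ℕ) + 1 < L),
      e i = conjCocycle κ.kerSubgroup γ (e ⟨(i : ℕ) + 1, hi⟩) - e ⟨(i : ℕ) + 1, hi⟩)
    (t : W.subgroupH1 p κ.kerSubgroup)
    (htop : resH1Hom (ContinuousMonoidHom.id κ.kerSubgroup)
      (AddSubgroup.inclusion (pkTorsion_le_geomPrimaryTorsion W p k)) (fun _ _ => rfl)
      (oneCocycleClass _ (e ⟨L - 1, by omega⟩)) = t)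
    (htL : (⇑(W.conjH1 p κ.kerSubgroup γ - AddMonoidHom.id (W.subgroupH1 p κ.kerSubgroup)))^[L] t = 0) :
    oneCocycleClass _ (conjCocycle κ.kerSubgroup γ (e ⟨0, hL⟩) - e ⟨0, hL⟩) = 0 := by
  have h0 : oneCocycleClass _ (e ⟨0, hL⟩) =
      (⇑(conjH1 κ.kerSubgroup (geomTorsion W ((p : ℤ) ^ k)) γ -
        AddMonoidHom.id (subgroupH1 κ.kerSubgroup (geomTorsion W ((p : ℤ) ^ k)))))^[L - 1]
        (oneCocycleClass _ (e ⟨L - 1, by omega⟩)) := by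
    have h := coordClass_eq_iterate κ γ e he (L - 1) (by omega)
    have hidx : (⟨L - 1 - (L - 1), (by omega : L - 1 - (L - 1) < L)⟩ : Fin L) = ⟨0, hL⟩ :=
      Fin.ext (by simp)
    rw [hidx] at h
    exact h
  have h1 : conjH1 κ.kerSubgroup (geomTorsion W ((p : ℤ) ^ k)) γ (oneCocycleClass _ (e ⟨0, hL⟩)) -
      oneCocycleClass _ (e ⟨0, hL⟩) =
      (⇑(conjH1 κ.kerSubgroup (geomTorsion W ((p : ℤ) ^ k)) γ -
        AddMonoidHom.id (subgroupH1 κ.kerSubgroup (geomTorsion W ((p : ℤ) ^ k)))))^[L]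
        (oneCocycleClass _ (e ⟨L - 1, by omega⟩)) := by
    rw [h0]
    change (⇑(conjH1 κ.kerSubgroup (geomTorsion W ((p : ℤ) ^ k)) γ -
        AddMonoidHom.id (subgroupH1 κ.kerSubgroup (geomTorsion W ((p : ℤ) ^ k))))) _ = _
    rw [← Function.iterate_succ_apply' (f := ⇑(conjH1 κ.kerSubgroup (geomTorsion W ((p : ℤ) ^ k)) γ -
        AddMonoidHom.id (subgroupH1 κ.kerSubgroup (geomTorsion W ((p : ℤ) ^ k))))),
      show Nat.succ (L - 1) = L by omega]
  apply resH1Hom_pkTorsion_injective_of_fixed W p k κ.kerSubgroup hE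
  rw [map_zero, oneCocycleClass_sub, ← conjH1_oneCocycleClass, h1,
    ← iterate_conjH1_sub_resH1Hom_pkTorsion, htop, htL]

/-! ## §3 The defect argument: eventual principality on `D ∩ Γ_∞` over `E[p^k]` -/

/-- **THE PRINCIPALITY BOUND.**  Let `D ≤ Γ_K`, `d ∈ D`, `u₀ ∈ Γ_∞`, `γ = d u₀`.  There is `N₀`
(depending only on `W, p, k, D, d, u₀`) such that for every `L ≥ 1` and every family
`e_0, …, e_{L−1} ∈ Z¹(Γ_∞, E[p^k])` with `e_i = γ·e_{i+1} − e_{i+1}`, whose TOP member is principal on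
`D ∩ Γ_∞` over `E[p^∞]` and whose BOTTOM member has `[γ·e_0 − e_0] = 0`, every `e_i` with
`L − 1 − i ≥ N₀` is principal on `D ∩ Γ_∞` over `E[p^k]`: `e_i u = u•x − x`.  (Roots `a_i` with
`p^k a_i = (d−1)^{L−1−i} p^k a_{L−1}` in `B = E[p^∞]^{D ∩ Γ_∞}`; the bottom class gives
`(d−1)^L p^k a_{L−1} ∈ p^k B`; the defect bound of part 5 in the finite group `B/p^kB`; and
`p^k a_i ∈ p^k B` makes `e_i` principal over `E[p^k] = E[p^∞][p^k]`.)
[cite: GreenbergLNM1716, §3 Lemma 3.1 (proof)] [cite: SerreGaloisCohomology1997, I §5.1] -/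
theorem exists_principalBound [W.IsElliptic] (D : Subgroup (absoluteGaloisGroup K))
    {d u₀ γ : absoluteGaloisGroup K} (hdD : d ∈ D) (hu₀ : u₀ ∈ κ.kerSubgroup) (hγ : d * u₀ = γ) :
    ∃ N₀ : ℕ, ∀ (L : ℕ) (hL : 0 < L)
      (e : Fin L → contOneCocycles (discreteTopRep κ.kerSubgroup (geomTorsion W ((p : ℤ) ^ k)))),
      (∀ (i : Fin L) (hi : (i : ℕ) + 1 < L),
        e i = conjCocycle κ.kerSubgroup γ (e ⟨(i : ℕ) + 1, hi⟩) - e ⟨(i : ℕ) + 1, hi⟩) →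
      (∃ a : geomPrimaryTorsion W p, ∀ (u : absoluteGaloisGroup K) (hu : u ∈ D ⊓ κ.kerSubgroup),
        AddSubgroup.inclusion (pkTorsion_le_geomPrimaryTorsion W p k)
          ((e ⟨L - 1, by omega⟩).1 ⟨u, hu.2⟩) = u • a - a) →
      oneCocycleClass _ (conjCocycle κ.kerSubgroup γ (e ⟨0, hL⟩) - e ⟨0, hL⟩) = 0 →
      ∀ i : Fin L, N₀ ≤ L - 1 - i →
        ∃ x : geomTorsion W ((p : ℤ) ^ k), ∀ (u : absoluteGaloisGroup K) (hu : u ∈ D ⊓ κ.kerSubgroup),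
          (e i).1 ⟨u, hu.2⟩ = u • x - x := by
  subst hγ
  -- notation
  let ι : geomTorsion W ((p : ℤ) ^ k) →+ geomPrimaryTorsion W p :=
    AddSubgroup.inclusion (pkTorsion_le_geomPrimaryTorsion W p k)
  have hι : ∀ (g : absoluteGaloisGroup K) (s : geomTorsion W ((p : ℤ) ^ k)), ι (g • s) = g • ι s :=
    fun _ _ => rfl
  have hDH : D ⊓ κ.kerSubgroup ≤ κ.kerSubgroup := inf_le_right
  have hd : ∀ u ∈ D ⊓ κ.kerSubgroup, d⁻¹ * u * d ∈ D ⊓ κ.kerSubgroup := fun u hu =>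
    ⟨D.mul_mem (D.mul_mem (D.inv_mem hdD) hu.1) hdD, by
      simpa using Subgroup.Normal.conj_mem inferInstance u hu.2 d⁻¹⟩
  have hn : ∀ s : geomTorsion W ((p : ℤ) ^ k), p ^ k • s = 0 := W.pow_nsmul_geomTorsion_eq_zero p k
  -- `E[p^∞][p^k] ⊆ ι E[p^k]`
  have htor : ∀ m : geomPrimaryTorsion W p, p ^ k • m = 0 → ∃ s : geomTorsion W ((p : ℤ) ^ k), ι s = m := by
    intro m hm
    have hmem : ((m : geomPrimaryTorsion W p) : geomPoints W) ∈ geomTorsion W ((p : ℤ) ^ k) := by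
      change ((p : ℤ) ^ k) • ((m : geomPrimaryTorsion W p) : geomPoints W) = 0
      rw [← Nat.cast_pow, natCast_zsmul, ← AddSubgroupClass.coe_nsmul, hm, ZeroMemClass.coe_zero]
    exact ⟨⟨_, hmem⟩, rfl⟩
  -- the defect bound of part 5
  obtain ⟨N₀, hN₀⟩ := exists_defectBound W p k (D ⊓ κ.kerSubgroup) hd
  refine ⟨N₀, fun L hL e he htop hbot i hi => ?_⟩
  obtain ⟨a₀, ha₀⟩ := htop
  -- the root of `e_i` and its defect `(d−1)^{L−1−i} (p^k a₀)`
  obtain ⟨a, ha, hna⟩ := exists_root_iterate κ.kerSubgroup (D ⊓ κ.kerSubgroup) hDH ι hι hL e hu₀ hd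
    hn he ha₀ (L - 1 - i) (by omega)
  have hidx : (⟨L - 1 - (L - 1 - (i : ℕ)), (by omega : L - 1 - (L - 1 - (i : ℕ)) < L)⟩ : Fin L) = i :=
    Fin.ext (by simp; omega)
  rw [hidx] at ha
  -- the root of `γ·e_0 − e_0` and its defect `(d−1)^L (p^k a₀)`, which lies in `p^k B`
  obtain ⟨a', ha', hna'⟩ := exists_root_beyond κ.kerSubgroup (D ⊓ κ.kerSubgroup) hDH ι hι hL e hu₀
    hd hn he ha₀
  obtain ⟨x₀, hx₀⟩ := (oneCocycleClass_eq_zero_iff _ _).1 hbot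
  have hx₀' : ∀ (u : absoluteGaloisGroup K) (hu : u ∈ D ⊓ κ.kerSubgroup),
      ι ((conjCocycle κ.kerSubgroup (d * u₀) (e ⟨0, hL⟩) - e ⟨0, hL⟩).1 ⟨u, hDH hu⟩) =
        u • ι x₀ - ι x₀ := by
    intro u hu
    rw [hx₀ ⟨u, hDH hu⟩, map_sub]
    rfl
  have hβ : ∀ u ∈ D ⊓ κ.kerSubgroup, u • (a' - ι x₀) = a' - ι x₀ :=
    smul_sub_root_eq κ.kerSubgroup (D ⊓ κ.kerSubgroup) hDH ι _ ha' hx₀'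
  have hLmem : (fun m : geomPrimaryTorsion W p => d • m - m)^[L] (p ^ k • a₀) = p ^ k • (a' - ι x₀) := by
    rw [← hna', smul_sub, ← map_nsmul, hn, map_zero, sub_zero]
  -- the defect bound: `(d−1)^{L−1−i} (p^k a₀) ∈ p^k B`
  have hfix₀ : ∀ u ∈ D ⊓ κ.kerSubgroup, u • (p ^ k • a₀) = p ^ k • a₀ :=
    smul_nsmul_root_eq κ.kerSubgroup (D ⊓ κ.kerSubgroup) hDH ι _ hn ha₀
  obtain ⟨β, hβfix, hβeq⟩ := hN₀ (p ^ k • a₀) hfix₀ ⟨L, a' - ι x₀, hβ, hLmem⟩ (L - 1 - i) hi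
  -- conclude
  have hna'' : p ^ k • a = p ^ k • β := hna.trans hβeq
  obtain ⟨x, hx⟩ := principal_of_root κ.kerSubgroup (D ⊓ κ.kerSubgroup) hDH ι hι
    (AddSubgroup.inclusion_injective _) htor (e i) ha hβfix hna''
  exact ⟨x, fun u hu => hx u hu⟩

/-! ## §4 The shifted cocycle is principal on `D ∩ Γ_∞` -/

/-- **`S^m ψ` is principal on `D ∩ Γ_∞` for `m ≥ N₀`.**  If the coordinate cocycles `e_i` of `ψ` on
`Γ_∞` (`ψ(τ)_i = e_i(τ)`) are principal on `D ∩ Γ_∞` whenever `L − 1 − i ≥ N₀`, then for `m ≥ N₀` the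
cocycle `S^m ∘ ψ` (coordinates `0, …, 0, e_0, …, e_{L−1−m}`) satisfies
`(S^m ψ)(u) = u·x − x` on `D ∩ ker κ⁻¹ = D ∩ Γ_∞`, where `Γ_∞` acts coordinatewise on
`𝒯^{(k)}_L(E, κ⁻¹)`. [cite: Washington1997, §13.1–§13.2] [cite: SerreGaloisCohomology1997, I §5.1] -/
theorem shiftPowCocyclePk_principal (L : ℕ) (D : Subgroup (absoluteGaloisGroup K))
    (ψ : contOneCocycles (W.modPkTwist p k κ.invTwist L).toTopRep)
    (e : Fin L → contOneCocycles (discreteTopRep κ.kerSubgroup (geomTorsion W ((p : ℤ) ^ k))))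
    (hψe : ∀ (τ : κ.kerSubgroup) (i : Fin L), ψ.1 (τ : absoluteGaloisGroup K) i = (e i).1 τ)
    {N₀ : ℕ}
    (hP : ∀ i : Fin L, N₀ ≤ L - 1 - i → ∃ x : geomTorsion W ((p : ℤ) ^ k),
      ∀ (u : absoluteGaloisGroup K) (hu : u ∈ D ⊓ κ.kerSubgroup), (e i).1 ⟨u, hu.2⟩ = u • x - x)
    {m : ℕ} (hm : N₀ ≤ m) :
    ∃ x : Fin L → geomTorsion W ((p : ℤ) ^ k), ∀ u ∈ D ⊓ κ.invTwist.kerSubgroup,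
      (κ.invTwist.shiftPowCocyclePk (W.torsionGaloisModule ((p : ℤ) ^ k))
          (W.pow_nsmul_geomTorsion_eq_zero p k) L m ψ).1 u =
        W.modPkTwist p k κ.invTwist L u x - x := by
  classical
  have hP' : ∀ i : Fin L, ∃ x : geomTorsion W ((p : ℤ) ^ k), N₀ ≤ L - 1 - i →
      ∀ (u : absoluteGaloisGroup K) (hu : u ∈ D ⊓ κ.kerSubgroup), (e i).1 ⟨u, hu.2⟩ = u • x - x := by
    intro i
    by_cases h : N₀ ≤ L - 1 - i
    · obtain ⟨x, hx⟩ := hP i h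
      exact ⟨x, fun _ => hx⟩
    · exact ⟨0, fun h' => absurd h' h⟩
  choose xs hxs using hP'
  refine ⟨fun i => if h : m ≤ (i : ℕ) then xs ⟨(i : ℕ) - m, by omega⟩ else 0, fun u hu => ?_⟩
  have huK : u ∈ κ.kerSubgroup := by
    have h := hu.2
    rwa [ZpExtension.invTwist, ZpExtension.kerSubgroup_unitTwist] at h
  rw [ZpExtension.shiftPowCocyclePk_apply, modPkTwist_invTwist_apply_of_mem_kerSubgroup W p k κ L huK]
  funext i
  rw [shiftEnd_pow_apply, Pi.sub_apply]
  by_cases hi : (i : ℕ) < m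
  · rw [dif_pos hi, dif_neg (by omega), smul_zero, sub_zero]
  · rw [dif_neg hi]
    have him : m ≤ (i : ℕ) := by omega
    rw [dif_pos him]
    change ψ.1 u ⟨(i : ℕ) - m, _⟩ = _
    rw [show ψ.1 u ⟨(i : ℕ) - m, by omega⟩ = (e ⟨(i : ℕ) - m, by omega⟩).1 ⟨u, huK⟩ from
      hψe ⟨u, huK⟩ ⟨(i : ℕ) - m, by omega⟩]
    exact hxs ⟨(i : ℕ) - m, by omega⟩ (by simp; omega) u ⟨hu.1, huK⟩

end Summit.BirchSwinnertonDyer.BirchSwinnertonDyer.Theorems.OneSidedTwistSqueezeX9KatoDivisibilityX9StubTestCocyclePkLevelX9Principal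

end
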